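import Mathlib
import Summits.Ventures.PercRepro2.SwAllGlueAll

/-!
# Row 2′SW-ALL when `l` and `h` are adjacent: the side is empty (blind cell PercRepro2, night-4
g33, 2026-08-28; proofs/NIGHT4-G33.md §9)

An edge joining `l` to `h` is red or blue, so `h` lies in the red or in the blue cluster of `l` at
every configuration: the side `Q = {h ∉ H_l, o ∈ R_side(l)}` of row 2′SW-ALL is EMPTY
(`tgtU_eq_empty_of_edge_lh`) and the row holds vacuously (`swAll_of_adj_lh`, through g6's
`swAll_of_empty`), as does row (SW) (`sw_of_adj_lh`).  The lane's coverage model had no such step: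
it dropped the edge `l–h` by the `{l, h}`-bridge lemma and recursed, counting the pair as open when
the smaller graph was — 344 of the 481 open pairs at `n = 6` and 14,873 of the 26,325 at `n = 7`
are settled by this lemma (NIGHT4-G33.md §9).
-/

namespace Summit.Ventures.PercRepro2

namespace LocRows

open Hull

variable {V : Type*} {E : Type*} [Fintype E] [DecidableEq E]

open scoped Classical

variable {ends : E → Sym2 V} {l h o : V}

/-- **The side of row 2′SW-ALL is empty when an edge joins `l` and `h`.** -/
theorem tgtU_eq_empty_of_edge_lh {e : E} (he : ends e = s(l, h)) :
    tgtU ends l h {S : Set V | o ∈ S} = ∅ := by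
  rw [Finset.eq_empty_iff_forall_notMem]
  intro ζ hζ
  simp only [tgtU, Finset.mem_filter, Finset.mem_univ, true_and] at hζ
  apply hζ.1
  cases hc : ζ e with
  | true => exact Or.inl (conn_of_openAdj ⟨e, hc, he⟩)
  | false =>
    have hb : blue ζ e = true := by rw [blue_eq_true_iff]; exact hc
    exact Or.inr (conn_of_openAdj ⟨e, hb, he⟩)

/-- **Row 2′SW-ALL holds vacuously when `l` and `h` are adjacent.** -/
theorem swAll_of_adj_lh {e : E} (he : ends e = s(l, h)) : SwAll ends l h o :=
  Glue.swAll_of_empty (tgtU_eq_empty_of_edge_lh he)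

/-- **Row (SW) holds vacuously when `l` and `h` are adjacent.** -/
theorem sw_of_adj_lh {e : E} (he : ends e = s(l, h)) : Sw ends l h o :=
  sw_of_swAll ends (swAll_of_adj_lh he)

end LocRows

end Summit.Ventures.PercRepro2
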